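import Literature.NumberTheory.LFunctions.BCHCrossMainReduction
import Literature.NumberTheory.Sieve.VinogradovExpSumTools
import HarnessLib

/-!
# The cross term of the BCH mean square: the `μ` not divisible by `k'` contribute `O((X + k') log k')`

Topic `Literature/NumberTheory/LFunctions`. Everything in this file is PROVED (no definitions, no
named facts).

In the main sum `Σ_{h,k} a_h ā_k (2π/k) Σ_{μ ≤ X} Σ_{ν ∈ crossNuSet} e^{-ic}` of the cross term of the
Balasubramanian–Conrey–Heath-Brown mean square (`BCH.mainSum_eq`), `e^{-ic} = e(−ν · μh'/k')` with
`h' = h/(h,k)`, `k' = k/(h,k)`, and for fixed `μ` the switched-on `ν` form an interval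
(`BCH.crossNuSet_eq_Ioc`). For `k' ∤ μ` the inner sum is therefore a geometric sum of modulus
`≤ 1/(2‖μh'/k'‖)` (Nathanson, Lemma 4.7, vendored in `Literature.NumberTheory.Sieve.VinogradovExpSumTools`),
and over any `k'` consecutive `μ` the points `μh'/k'` are `1/k'`-separated, so that
(`sum_inv_distInt_le_of_separated`) these `μ` contribute `≤ k'(1 + log k')` per block:

* `BCH.le_distInt_int_div` — `‖n/q‖ ≥ 1/q` for an integer `n` with `q ∤ n`;
* `BCH.cexp_neg_I_crossFreq` — `e^{-ic} = e(ν · (−μh/k))`;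
* `BCH.norm_nuSum_le_inv_distInt` — `|Σ_{ν ∈ crossNuSet} e^{-ic}| ≤ 1/(2‖μh'/k'‖)` for `k' ∤ μ`;
* `BCH.sum_block_inv_distInt_le` — `Σ_{jk' < μ ≤ (j+1)k', k' ∤ μ} 1/(2‖μh'/k'‖) ≤ k'(1 + log k')`;
* `BCH.norm_nondivSum_le` — **`|Σ_{μ ≤ X, k' ∤ μ} Σ_{ν ∈ crossNuSet} e^{-ic}| ≤ (X/k' + 1) k' (1 + log k')`.**

## References

* [Titchmarsh1986] E. C. Titchmarsh, *The Theory of the Riemann Zeta-Function*, 2nd ed. (1986), §9.22.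
* [Nathanson1996] M. B. Nathanson, *Additive Number Theory: The Classical Bases*, GTM 164, §4.4,
  Lemmas 4.7–4.9.
-/

noncomputable section

open Finset Real Complex
open scoped FourierTransform

namespace Literature.NumberTheory.LFunctions.BCH

open Literature.NumberTheory.Sieve.Vinogradov

/-! ### Distance to the nearest integer of a fraction -/

/-- `‖n/q‖ ≥ 1/q` for an integer `n` not divisible by `q ≥ 1`. [folklore] -/
theorem le_distInt_int_div {n : ℤ} {q : ℕ} (hq : 0 < q) (hn : ¬ (q : ℤ) ∣ n) :
    1 / (q : ℝ) ≤ distInt ((n : ℝ) / q) := by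
  have hqR : (0 : ℝ) < q := by exact_mod_cast hq
  unfold distInt
  set m : ℤ := round ((n : ℝ) / q) with hm
  have hne : n - q * m ≠ 0 := by
    intro h0
    apply hn
    exact ⟨m, by linarith⟩
  have habs : (1 : ℝ) ≤ |((n - q * m : ℤ) : ℝ)| := by
    rw [← Int.cast_abs]
    exact_mod_cast Int.one_le_abs hne
  have e : (n : ℝ) / q - m = ((n - q * m : ℤ) : ℝ) / q := by
    push_cast
    field_simp
  rw [e, abs_div, abs_of_pos hqR, le_div_iff₀ hqR, div_mul_cancel₀ _ hqR.ne']
  exact habs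

/-! ### The phase as an additive character -/

/-- `e^{-ic} = e(ν · (−μh/k))` with `e(x) = exp(2πix)`. [folklore] -/
theorem cexp_neg_I_crossFreq (h k μ ν : ℕ) :
    cexp (-I * crossFreq h k μ ν) = (𝐞 ((ν : ℝ) * (-((μ : ℝ) * h / k))) : ℂ) := by
  rw [Real.fourierChar_apply, crossFreq_def]
  congr 1
  push_cast
  ring

/-- `h/k = h'/k'` with `h' = h/(h,k)`, `k' = k/(h,k)`. [folklore] -/
theorem div_eq_div_gcd (h k : ℕ) (hk : 0 < k) :
    (h : ℝ) / k = ((h / Nat.gcd h k : ℕ) : ℝ) / ((k / Nat.gcd h k : ℕ) : ℝ) := by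
  have hg : 0 < Nat.gcd h k := Nat.gcd_pos_of_pos_right h hk
  have hgR : (0 : ℝ) < Nat.gcd h k := by exact_mod_cast hg
  have hkR : (0 : ℝ) < k := by exact_mod_cast hk
  have e1 : ((h / Nat.gcd h k : ℕ) : ℝ) = (h : ℝ) / Nat.gcd h k := by
    rw [Nat.cast_div (Nat.gcd_dvd_left h k) hgR.ne']
  have e2 : ((k / Nat.gcd h k : ℕ) : ℝ) = (k : ℝ) / Nat.gcd h k := by
    rw [Nat.cast_div (Nat.gcd_dvd_right h k) hgR.ne']
  rw [e1, e2]
  field_simp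

/-- `k' ∤ μ ⟹ k' ∤ μh'` (`(h', k') = 1`). [folklore] -/
theorem not_dvd_mul_reduced {h k μ : ℕ} (hk : 0 < k) (hμ : ¬ (k / Nat.gcd h k) ∣ μ) :
    ¬ ((k / Nat.gcd h k : ℕ) : ℤ) ∣ ((μ * (h / Nat.gcd h k) : ℕ) : ℤ) := by
  intro hd
  have hd' : (k / Nat.gcd h k) ∣ μ * (h / Nat.gcd h k) := by exact_mod_cast hd
  have hcop : Nat.Coprime (k / Nat.gcd h k) (h / Nat.gcd h k) := by
    have := Nat.coprime_div_gcd_div_gcd (m := h) (n := k) (Nat.gcd_pos_of_pos_right h hk)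
    exact this.symm
  exact hμ (hcop.dvd_of_dvd_mul_right hd')

/-- `‖μh/k‖ ≥ 1/k'` for `k' ∤ μ`. [folklore] -/
theorem le_distInt_mul_div {h k μ : ℕ} (hk : 0 < k) (hμ : ¬ (k / Nat.gcd h k) ∣ μ) :
    1 / ((k / Nat.gcd h k : ℕ) : ℝ) ≤ distInt (-((μ : ℝ) * h / k)) := by
  rw [distInt_neg]
  have hk' : 0 < k / Nat.gcd h k := Nat.div_pos (Nat.le_of_dvd hk (Nat.gcd_dvd_right h k))
    (Nat.gcd_pos_of_pos_right h hk)
  have e : (μ : ℝ) * h / k = (((μ * (h / Nat.gcd h k) : ℕ) : ℤ) : ℝ) / ((k / Nat.gcd h k : ℕ) : ℝ) := by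
    rw [mul_div_assoc, div_eq_div_gcd h k hk]
    simp only [Nat.cast_mul, Int.cast_mul, Int.cast_natCast]
    ring
  rw [e]
  exact le_distInt_int_div hk' (not_dvd_mul_reduced hk hμ)

/-! ### One `μ` with `k' ∤ μ` -/

/-- **`|Σ_{ν ∈ crossNuSet} e^{-ic}| ≤ 1/(2‖μh/k‖)` for `k' ∤ μ`** (a geometric sum over an
interval of `ν`). [cite: Nathanson1996, Lemma 4.7] -/
theorem norm_nuSum_le_inv_distInt (T T' : ℝ) (X : ℕ) {h k μ : ℕ} (hk : 0 < k)
    (hμ : ¬ (k / Nat.gcd h k) ∣ μ) :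
    ‖∑ ν ∈ crossNuSet T T' X h k μ, cexp (-I * crossFreq h k μ ν)‖ ≤
      1 / (2 * distInt (-((μ : ℝ) * h / k))) := by
  obtain ⟨a, b, -, hab⟩ := crossNuSet_eq_Ioc T T' X h k μ
  rw [hab]
  simp_rw [cexp_neg_I_crossFreq]
  have hd : 0 < distInt (-((μ : ℝ) * h / k)) := by
    have hk' : 0 < k / Nat.gcd h k := Nat.div_pos (Nat.le_of_dvd hk (Nat.gcd_dvd_right h k))
      (Nat.gcd_pos_of_pos_right h hk)
    have h1 : 0 < 1 / ((k / Nat.gcd h k : ℕ) : ℝ) := by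
      have : (0 : ℝ) < (k / Nat.gcd h k : ℕ) := by exact_mod_cast hk'
      positivity
    exact lt_of_lt_of_le h1 (le_distInt_mul_div hk hμ)
  rw [le_div_iff₀ (by positivity)]
  have := norm_sum_Ioc_fourierChar_mul_distInt_le a b (-((μ : ℝ) * h / k))
  linarith

/-! ### A block of `k'` consecutive `μ` -/

/-- **`Σ_{jk' < μ ≤ (j+1)k', k' ∤ μ} 1/(2‖μh/k‖) ≤ k'(1 + log k')`**: within a block the points
`μh'/k'` are `1/k'`-separated modulo one and `1/k'`-far from `0`. [cite: Nathanson1996, Lemma 4.9] -/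
theorem sum_block_inv_distInt_le {h k : ℕ} (hk : 0 < k) (j : ℕ) :
    ∑ μ ∈ (Finset.Ioc (j * (k / Nat.gcd h k)) ((j + 1) * (k / Nat.gcd h k))).filter
        (fun μ => ¬ (k / Nat.gcd h k) ∣ μ), 1 / (2 * distInt (-((μ : ℝ) * h / k))) ≤
      ((k / Nat.gcd h k : ℕ) : ℝ) * (1 + Real.log ((k / Nat.gcd h k : ℕ) : ℝ)) := by
  set k' : ℕ := k / Nat.gcd h k with hk'def
  have hk' : 0 < k' := Nat.div_pos (Nat.le_of_dvd hk (Nat.gcd_dvd_right h k))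
    (Nat.gcd_pos_of_pos_right h hk)
  have hk'R : (0 : ℝ) < k' := by exact_mod_cast hk'
  have hδ : (0 : ℝ) < 1 / k' := by positivity
  have hm : 1 / (2 * (1 / (k' : ℝ))) ≤ (k' : ℕ) := by
    rw [show (2 : ℝ) * (1 / k') = 2 / k' by ring, one_div_div]
    linarith
  have key := sum_inv_distInt_le_of_separated
    ((Finset.Ioc (j * k') ((j + 1) * k')).filter (fun μ => ¬ k' ∣ μ))
    (fun μ : ℕ => -((μ : ℝ) * h / k)) hδ hm ?_ ?_
  · refine key.trans (le_of_eq ?_)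
    rw [one_div_one_div]
  · -- separation
    intro i hi i' hi' hne
    rw [Finset.mem_filter, Finset.mem_Ioc] at hi hi'
    have e : -((i : ℝ) * h / k) - -((i' : ℝ) * h / k) = -(((i : ℝ) - i') * h / k) := by ring
    rw [e, distInt_neg]
    -- `(i - i') h / k = ((i - i') h') / k'` with `k' ∤ (i - i') h'`
    have hkR : (0 : ℝ) < k := by exact_mod_cast hk
    have hcop : Nat.Coprime k' (h / Nat.gcd h k) := by
      have := Nat.coprime_div_gcd_div_gcd (m := h) (n := k) (Nat.gcd_pos_of_pos_right h hk)
      exact this.symm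
    have hnd : ¬ ((k' : ℕ) : ℤ) ∣ (((i : ℤ) - i') * ((h / Nat.gcd h k : ℕ) : ℤ)) := by
      intro hd
      have hd1 : ((k' : ℕ) : ℤ) ∣ ((i : ℤ) - i') := by
        have hc : IsCoprime ((k' : ℕ) : ℤ) ((h / Nat.gcd h k : ℕ) : ℤ) :=
          Nat.isCoprime_iff_coprime.2 hcop
        exact hc.dvd_of_dvd_mul_right hd
      -- but `0 < |i - i'| < k'`
      obtain ⟨c, hc⟩ := hd1
      have h1 : ((i : ℤ) - i') ≠ 0 := by
        intro h0; apply hne; omega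
      have hlt1 : i < i' + k' :=
        calc i ≤ (j + 1) * k' := hi.1.2
          _ = j * k' + k' := by ring
          _ < i' + k' := Nat.add_lt_add_right hi'.1.1 k'
      have hlt2 : i' < i + k' :=
        calc i' ≤ (j + 1) * k' := hi'.1.2
          _ = j * k' + k' := by ring
          _ < i + k' := Nat.add_lt_add_right hi.1.1 k'
      have h2 : |(i : ℤ) - i'| < k' := by
        rw [abs_sub_lt_iff]
        constructor
        · have : (i : ℤ) < i' + k' := by exact_mod_cast hlt1
          linarith
        · have : (i' : ℤ) < i + k' := by exact_mod_cast hlt2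
          linarith
      rw [hc, abs_mul, Nat.abs_cast] at h2
      have hc0 : c ≠ 0 := by rintro rfl; simp at hc; exact h1 hc
      have : (1 : ℤ) ≤ |c| := Int.one_le_abs hc0
      have hk'Z : (0 : ℤ) < k' := by exact_mod_cast hk'
      nlinarith
    have e2 : ((i : ℝ) - i') * h / k =
        ((((i : ℤ) - i') * ((h / Nat.gcd h k : ℕ) : ℤ) : ℤ) : ℝ) / ((k' : ℕ) : ℝ) := by
      rw [mul_div_assoc, div_eq_div_gcd h k hk, ← hk'def]
      simp only [Int.cast_mul, Int.cast_sub, Int.cast_natCast]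
      ring
    rw [e2]
    exact le_distInt_int_div hk' hnd
  · -- far from zero
    intro i hi
    rw [Finset.mem_filter] at hi
    exact le_distInt_mul_div hk hi.2

/-! ### All `μ ≤ X` with `k' ∤ μ` -/

/-- **The `μ` not divisible by `k'` contribute `O((X + k') log k')`:**
`|Σ_{μ ≤ X, k' ∤ μ} Σ_{ν ∈ crossNuSet} e^{-ic}| ≤ (X/k' + 1) k' (1 + log k')`.
[cite: Titchmarsh1986, §9.22] -/
theorem norm_nondivSum_le (T T' : ℝ) (X : ℕ) {h k : ℕ} (hk : 0 < k) :
    ‖∑ μ ∈ (Finset.Icc 1 X).filter (fun μ => ¬ (k / Nat.gcd h k) ∣ μ),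
        ∑ ν ∈ crossNuSet T T' X h k μ, cexp (-I * crossFreq h k μ ν)‖ ≤
      ((X / (k / Nat.gcd h k) : ℕ) + 1 : ℝ) * (((k / Nat.gcd h k : ℕ) : ℝ) *
        (1 + Real.log ((k / Nat.gcd h k : ℕ) : ℝ))) := by
  set k' : ℕ := k / Nat.gcd h k with hk'def
  have hk' : 0 < k' := Nat.div_pos (Nat.le_of_dvd hk (Nat.gcd_dvd_right h k))
    (Nat.gcd_pos_of_pos_right h hk)
  set J : ℕ := X / k' + 1 with hJ
  -- termwise bound by `1/(2‖μh/k‖)`, then cover `[1, X]` by the blocks `j < J`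
  have h1 : ‖∑ μ ∈ (Finset.Icc 1 X).filter (fun μ => ¬ k' ∣ μ),
      ∑ ν ∈ crossNuSet T T' X h k μ, cexp (-I * crossFreq h k μ ν)‖ ≤
      ∑ μ ∈ (Finset.Icc 1 X).filter (fun μ => ¬ k' ∣ μ), 1 / (2 * distInt (-((μ : ℝ) * h / k))) := by
    refine (norm_sum_le _ _).trans (Finset.sum_le_sum fun μ hμ => ?_)
    rw [Finset.mem_filter] at hμ
    exact norm_nuSum_le_inv_distInt T T' X hk hμ.2
  refine h1.trans ?_
  have hcover : (Finset.Icc 1 X).filter (fun μ => ¬ k' ∣ μ) ⊆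
      (Finset.range J).biUnion (fun j => (Finset.Ioc (j * k') ((j + 1) * k')).filter (fun μ => ¬ k' ∣ μ)) := by
    intro μ hμ
    rw [Finset.mem_filter, Finset.mem_Icc] at hμ
    rw [Finset.mem_biUnion]
    refine ⟨(μ - 1) / k', ?_, ?_⟩
    · rw [Finset.mem_range, hJ]
      have : (μ - 1) / k' ≤ X / k' := Nat.div_le_div_right (by omega)
      omega
    · rw [Finset.mem_filter, Finset.mem_Ioc]
      refine ⟨⟨?_, ?_⟩, hμ.2⟩
      · have := Nat.div_mul_le_self (μ - 1) k'
        omega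
      · have := Nat.lt_div_mul_add (a := μ - 1) hk'
        rw [add_mul, one_mul]
        omega
  have hnn : ∀ μ ∈ (Finset.range J).biUnion
      (fun j => (Finset.Ioc (j * k') ((j + 1) * k')).filter (fun μ => ¬ k' ∣ μ)),
      0 ≤ 1 / (2 * distInt (-((μ : ℝ) * h / k))) := fun μ _ => by
    have := distInt_nonneg (-((μ : ℝ) * h / k)); positivity
  refine (Finset.sum_le_sum_of_subset_of_nonneg hcover (fun μ hμ _ => hnn μ hμ)).trans ?_
  have hdisj : Set.PairwiseDisjoint (↑(Finset.range J))
      (fun j => (Finset.Ioc (j * k') ((j + 1) * k')).filter (fun μ => ¬ k' ∣ μ)) := by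
    intro j _ j' _ hne
    simp only [Function.onFun]
    rw [Finset.disjoint_left]
    intro μ hμ hμ'
    rw [Finset.mem_filter, Finset.mem_Ioc] at hμ hμ'
    apply hne
    have h1 : j * k' < (j' + 1) * k' := lt_of_lt_of_le hμ.1.1 hμ'.1.2
    have h2 : j' * k' < (j + 1) * k' := lt_of_lt_of_le hμ'.1.1 hμ.1.2
    have := Nat.lt_of_mul_lt_mul_right h1
    have := Nat.lt_of_mul_lt_mul_right h2
    omega
  rw [Finset.sum_biUnion hdisj]
  calc ∑ j ∈ Finset.range J, ∑ μ ∈ (Finset.Ioc (j * k') ((j + 1) * k')).filter (fun μ => ¬ k' ∣ μ),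
        1 / (2 * distInt (-((μ : ℝ) * h / k)))
      ≤ ∑ j ∈ Finset.range J, ((k' : ℕ) : ℝ) * (1 + Real.log ((k' : ℕ) : ℝ)) :=
        Finset.sum_le_sum fun j _ => sum_block_inv_distInt_le hk j
    _ = (J : ℝ) * (((k' : ℕ) : ℝ) * (1 + Real.log ((k' : ℕ) : ℝ))) := by
        rw [Finset.sum_const, Finset.card_range, nsmul_eq_mul]
    _ = _ := by rw [hJ]; push_cast; ring

end Literature.NumberTheory.LFunctions.BCH
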